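import Summits.NavierStokesRegularity.TurbBounds.CouplingSplit
import Summits.NavierStokesRegularity.TurbBounds.TailP2R3TableN12
import HarnessLib

/-!
# Row P2-R3 tail lemma (N12) — the exact coupling through profile mode `p = 2`: `couplingMode 12 5 2` written out with the
kernel-certified triple-product values (GENERATED by HOME/pub-turb-cert/lean-tail-v2/tailgen/emit/emit_tail.py N12 P2R3; kernel arithmetic only).

HONEST FRAMING: rigorous bounds for the stated PDE and boundary conditions; no claim about physical turbulence beyond the bound.
-/

set_option linter.style.longLine false
set_option linter.style.setOption false

noncomputable section

namespace Summit.NavierStokesRegularity.TurbBounds.TailP2R3.N12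

open Finset
open Summit.NavierStokesRegularity.TurbBounds.LadderTail (w)
open Summit.NavierStokesRegularity.TurbBounds.LegendreTriple (tripleCoeff)
open Summit.NavierStokesRegularity.TurbBounds.CouplingSplit (couplingMode)

set_option maxRecDepth 100000 in
set_option maxHeartbeats 20000000 in
/-- `couplingMode 12 5 2 b e` = the explicit `Λ`-weighted bilinear form over the index set `S` (profile mode `2`). -/
theorem couplingMode_2_eq (b e : ℕ → ℝ) :
    couplingMode 12 5 2 b e = (2/5 : ℝ) * (b 0 * e 2) + (4/15 : ℝ) * (b 1 * e 1) + (6/35 : ℝ) * (b 1 * e 3) + (2/5 : ℝ) * (b 2 * e 0) + (4/35 : ℝ) * (b 2 * e 2) + (4/35 : ℝ) * (b 2 * e 4) + (6/35 : ℝ) * (b 3 * e 1) + (8/105 : ℝ) * (b 3 * e 3) + (20/231 : ℝ) * (b 3 * e 5) + (4/35 : ℝ) * (b 4 * e 2) + (40/693 : ℝ) * (b 4 * e 4) + (10/143 : ℝ) * (b 4 * e 6) + (20/231 : ℝ) * (b 5 * e 3) + (20/429 : ℝ) * (b 5 * e 5) + (42/715 : ℝ) * (b 5 * e 7) + (10/143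 : ℝ) * (b 6 * e 4) + (28/715 : ℝ) * (b 6 * e 6) + (56/1105 : ℝ) * (b 6 * e 8) + (42/715 : ℝ) * (b 7 * e 5) + (112/3315 : ℝ) * (b 7 * e 7) + (72/1615 : ℝ) * (b 7 * e 9) + (56/1105 : ℝ) * (b 8 * e 6) + (48/1615 : ℝ) * (b 8 * e 8) + (90/2261 : ℝ) * (b 8 * e 10) + (72/1615 : ℝ) * (b 9 * e 7) + (60/2261 : ℝ) * (b 9 * e 9) + (110/3059 : ℝ) * (b 9 * e 11) + (90/2261 : ℝ) * (b 10 * e 8) + (220/9177 : ℝ) * (b 10 * e 10) + (132/4025 : ℝ) * (b 10 * e 12) + (110/3059 : ℝ) * (b 11 * e 9) + (88/4025 : ℝ) * (b 11 * e 11) + (52/1725 : ℝ) * (b 11 * e 13) + (132/4025 : ℝ) * (b 12 * e 10) + (104/5175 : ℝ) * (b 12 * e 12) + (182/6525 : ℝ) * (b 12 * e 14) + (52/1725 : ℝ) * (b 13 * e 11) + (182/6525 : ℝ) * (b 14 * e 12) := by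
  unfold couplingMode
  simp (maxSteps := 20000000) only [sum_range_succ, sum_range_zero, zero_add]
  norm_num only [tripleCoeff_eq_tab, tab, slices, slice0, slice1, slice2, slice3, slice4, slice5, List.getD_cons_zero, List.getD_cons_succ, List.getD_nil, w,
    true_or, or_true, or_false, false_or, if_true, if_false]
  ring

end Summit.NavierStokesRegularity.TurbBounds.TailP2R3.N12

end
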